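import Summits.CriticalPhenomena.PercolationContinuityZ3.Theorems.PercNearOneGluingNoHeavyLowerTailCubicFourPointL1CertKernel
import Mathlib.Algebra.Order.BigOperators.Group.Finset
import Mathlib.Algebra.Order.BigOperators.Group.List
import Mathlib.Algebra.BigOperators.Intervals
import Mathlib.Tactic.IntervalCases
import Mathlib.Tactic.Ring
import Mathlib.Tactic.Linarith
import Mathlib.Tactic.Positivity
import HarnessLib

/-!
# Four-point certificate kernel, semantic layer: what the compiled expressions denote

For a valuation `x : ℕ → ℝ` of the 15 cells (`ctxOf x`), the `Lean.Grind.CommRing.Expr` built by `…L1CertKernel` denote: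
`maskE m ↦ msum m x = Σ_{i<15, bit i of m} x i`, `rowE r ↦ rowVal r x`, `multTermE (c,mono,r) ↦ (x 2 − x 1)^r · (c · ∏ mono)`,
`certE bs ↦ Σ` of all terms, `polyE M ↦ Σ c·mono`, `l1E ↦ L1hom x`.  Consequences: `certE` denotes a nonnegative number as soon as
the cells are nonnegative, `x 1 ≤ x 2` and every row value is nonnegative (`denote_certE_nonneg`); `polyE M` denotes a positive number when some positive cell's square occurs with positive coefficient (`polyVal_pos_of_square`).
-/

namespace Summit.CriticalPhenomena.PercolationContinuityZ3.Theorems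

namespace FourPointCert

open Lean.Grind.CommRing Finset

/-! ### The context and the unfolding of `denote` -/

/-- The valuation of the 15 cell variables as a kernel-friendly random-access array. [this work] -/
noncomputable def ctxOf (x : ℕ → ℝ) : Context ℝ :=
  .branch 8
    (.branch 4 (.branch 2 (.branch 1 (.leaf (x 0)) (.leaf (x 1))) (.branch 3 (.leaf (x 2)) (.leaf (x 3))))
      (.branch 6 (.branch 5 (.leaf (x 4)) (.leaf (x 5))) (.branch 7 (.leaf (x 6)) (.leaf (x 7)))))
    (.branch 12 (.branch 10 (.branch 9 (.leaf (x 8)) (.leaf (x 9))) (.branch 11 (.leaf (x 10)) (.leaf (x 11))))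
      (.branch 14 (.branch 13 (.leaf (x 12)) (.leaf (x 13))) (.leaf (x 14))))

variable (x : ℕ → ℝ)

/-- The context returns the cells. [this work] -/
theorem ctxOf_get {i : ℕ} (hi : i < 15) : (ctxOf x).get i = x i := by
  interval_cases i <;> rfl

/-- `denote` of a variable below 15. [this work] -/
theorem denote_var {i : ℕ} (hi : i < 15) : (Expr.var i).denote (ctxOf x) = x i := by
  change (ctxOf x).get i = x i
  exact ctxOf_get x hi

/-- `denote` of a sum. [this work] -/
theorem denote_add (c : Context ℝ) (a b : Expr) : (Expr.add a b).denote c = a.denote c + b.denote c := rfl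
/-- `denote` of a difference. [this work] -/
theorem denote_sub (c : Context ℝ) (a b : Expr) : (Expr.sub a b).denote c = a.denote c - b.denote c := rfl
/-- `denote` of a product. [this work] -/
theorem denote_mul (c : Context ℝ) (a b : Expr) : (Expr.mul a b).denote c = a.denote c * b.denote c := rfl
/-- `denote` of a natural-number constant. [this work] -/
theorem denote_natCast (c : Context ℝ) (k : ℕ) : (Expr.natCast k).denote c = (k : ℝ) := rfl

/-! ### Masks -/

/-- `Σ_{i < 15, bit i of m set} x i`. [this work] -/
noncomputable def msum (m : ℕ) (x : ℕ → ℝ) : ℝ := ∑ i ∈ range 15, if m.testBit i then x i else 0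

/-- The loop of `maskE`. [this work] -/
theorem denote_maskE_go (m : ℕ) : ∀ (fuel i : ℕ) (acc : Expr), i + fuel ≤ 15 →
    (maskE.go m i fuel acc).denote (ctxOf x) = acc.denote (ctxOf x) + ∑ j ∈ Ico i (i + fuel), if m.testBit j then x j else 0 := by
  intro fuel
  induction fuel with
  | zero => intro i acc _; simp [maskE.go]
  | succ f ih =>
    intro i acc h
    have hi : i < 15 := by omega
    have e1 : i + 1 + f = i + (f + 1) := by omega
    rw [maskE.go, Finset.sum_eq_sum_Ico_succ_bot (show i < i + (f + 1) by omega), ih (i + 1) _ (by omega), e1]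
    split_ifs with hb
    · rw [denote_add, denote_var x hi]; ring
    · ring

/-- `maskE m` denotes `msum m x`. [this work] -/
theorem denote_maskE (m : ℕ) : (maskE m).denote (ctxOf x) = msum m x := by
  rw [maskE, denote_maskE_go x m 15 0 (.natCast 0) (by omega), denote_natCast, msum, Nat.cast_zero, zero_add, Nat.zero_add,
    Finset.range_eq_Ico]

/-! ### Rows -/

/-- `e₂` of a list: `Σ_{i<j} lᵢ lⱼ`. [this work] -/
def e2val : List ℝ → ℝ
  | [] => 0
  | a :: l => a * l.sum + e2val l

/-- `e2E` denotes `e2val`. [this work] -/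
theorem denote_e2E (c : Context ℝ) : ∀ l : List Expr, (e2E l).denote c = e2val (l.map fun e => e.denote c)
  | [] => by rw [e2E, denote_natCast, Nat.cast_zero, List.map_nil, e2val]
  | a :: l => by
    rw [e2E, denote_add, denote_mul, denote_e2E c l, List.map_cons, e2val]
    congr 2
    induction l with
    | nil => rw [List.foldr_nil, denote_natCast, Nat.cast_zero, List.map_nil, List.sum_nil]
    | cons b l ih => rw [List.foldr_cons, denote_add, ih, List.map_cons, List.sum_cons]

/-- The homogenised Richards–Sahi cubic on mask sums. [this work] -/
noncomputable def e3val (A B C : ℕ) (x : ℕ → ℝ) : ℝ :=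
  2 * msum full x * msum full x * msum (A &&& B &&& C) x + msum A x * msum B x * msum C x
    - msum full x * (msum A x * msum (B &&& C) x + msum B x * msum (A &&& C) x + msum C x * msum (A &&& B) x)

/-- `e3E` denotes `e3val`. [this work] -/
theorem denote_e3E (A B C : ℕ) : (e3E A B C).denote (ctxOf x) = e3val A B C x := by
  simp only [e3E, e3val, sigmaE, denote_add, denote_sub, denote_mul, denote_natCast, denote_maskE, Nat.cast_ofNat]

/-- The value of a row on a cell valuation. [this work] -/
noncomputable def rowVal : RowSpec → (ℕ → ℝ) → ℝ
  | .cell i, x => x i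
  | .harris E F, x => msum full x * msum (E &&& F) x - msum E x * msum F x
  | .sunflower A petals glued, x =>
    let g := fun (m : ℕ) => if glued then preGlue m else m
    msum (g A) x * msum (g (full ^^^ (A ||| unionMasks petals))) x - e2val (petals.map fun p => msum (g p) x)
  | .shk u v w glued, x =>
    let c := law3 u v w glued
    (msum full x + msum c.2.2.2.2 x) * (msum c.1 x * msum c.2.2.2.2 x
        - e2val [msum c.2.1 x, msum c.2.2.1 x, msum c.2.2.2.1 x]) - msum c.2.1 x * msum c.2.2.1 x * msum c.2.2.2.1 x
  | .hyb c P₁ P₃ P₃', x => e3val (gsepMask (2 ^ c) P₁) (gsepMask (2 ^ c) P₃) (gsepMask P₁ P₃') x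

/-- `rowE r` denotes `rowVal r x` (cell rows need `i < 15`). [this work] -/
theorem denote_rowE (r : RowSpec) (hr : ∀ i, r = .cell i → i < 15) : (rowE r).denote (ctxOf x) = rowVal r x := by
  cases r with
  | cell i => exact denote_var x (hr i rfl)
  | harris E F => simp only [rowE, rowVal, sigmaE, denote_sub, denote_mul, denote_maskE]
  | sunflower A petals glued =>
    simp only [rowE, rowVal, denote_sub, denote_mul, denote_maskE, denote_e2E, List.map_map, Function.comp_def]
  | shk u v w glued =>
    simp only [rowE, rowVal, sigmaE, denote_sub, denote_mul, denote_add, denote_maskE, denote_e2E, List.map_cons, List.map_nil]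
  | hyb c P₁ P₃ P₃' => simp only [rowE, rowVal, denote_e3E]

/-! ### Terms and the whole certificate -/

/-- Product of the cells of a monomial. [this work] -/
noncomputable def monoVal (l : List ℕ) (x : ℕ → ℝ) : ℝ := (l.map x).prod

/-- `monoE l` denotes `monoVal l x` (indices below 15). [this work] -/
theorem denote_monoE : ∀ l : List ℕ, (∀ i ∈ l, i < 15) → (monoE l).denote (ctxOf x) = monoVal l x
  | [], _ => by rw [monoE, denote_natCast, monoVal, List.map_nil, List.prod_nil, Nat.cast_one]
  | i :: l, h => by
    rw [monoE, denote_mul, denote_var x (h i (by simp)), denote_monoE l (fun k hk => h k (List.mem_cons_of_mem i hk)), monoVal,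
      monoVal, List.map_cons, List.prod_cons]

/-- Monomial values are nonnegative on nonnegative cells. [this work] -/
theorem monoVal_nonneg (hx : ∀ i, 0 ≤ x i) : ∀ l : List ℕ, 0 ≤ monoVal l x
  | [] => by rw [monoVal, List.map_nil, List.prod_nil]; exact zero_le_one
  | i :: l => by rw [monoVal, List.map_cons, List.prod_cons]; exact mul_nonneg (hx i) (monoVal_nonneg hx l)

/-- `regPowE r e` denotes `(x 2 − x 1)^r · e`. [this work] -/
theorem denote_regPowE (e : Expr) : ∀ r : ℕ, (regPowE r e).denote (ctxOf x) = (x 2 - x 1) ^ r * e.denote (ctxOf x)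
  | 0 => by simp [regPowE]
  | r + 1 => by
    rw [regPowE, denote_mul, denote_regPowE e r, regE, denote_sub, denote_var x (by norm_num), denote_var x (by norm_num)]; ring

/-- The value of a multiplier term. [this work] -/
noncomputable def multTermVal (t : ℕ × List ℕ × ℕ) (x : ℕ → ℝ) : ℝ := (x 2 - x 1) ^ t.2.2 * ((t.1 : ℝ) * monoVal t.2.1 x)

/-- `multTermE t` denotes `multTermVal t x`. [this work] -/
theorem denote_multTermE (t : ℕ × List ℕ × ℕ) (ht : ∀ i ∈ t.2.1, i < 15) : (multTermE t).denote (ctxOf x) = multTermVal t x := by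
  rw [multTermE, denote_regPowE, denote_mul, denote_natCast, denote_monoE x _ ht, multTermVal]

/-- A multiplier term is nonnegative on nonnegative cells with `x 1 ≤ x 2`. [this work] -/
theorem multTermVal_nonneg (t : ℕ × List ℕ × ℕ) (hx : ∀ i, 0 ≤ x i) (hreg : x 1 ≤ x 2) : 0 ≤ multTermVal t x := by
  unfold multTermVal
  exact mul_nonneg (pow_nonneg (sub_nonneg.2 hreg) _) (mul_nonneg (Nat.cast_nonneg _) (monoVal_nonneg x hx _))

/-- `pairUp` preserves the sum of denotations. [this work] -/
theorem denote_pairUp_sum (c : Context ℝ) : ∀ l : List Expr, ((pairUp l).map fun e => e.denote c).sum = (l.map fun e => e.denote c).sum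
  | [] => rfl
  | [_] => rfl
  | a :: b :: l => by
    rw [pairUp, List.map_cons, List.sum_cons, denote_add, denote_pairUp_sum c l, List.map_cons, List.map_cons, List.sum_cons,
      List.sum_cons, add_assoc]

/-- A left fold of additions denotes the sum. [this work] -/
theorem denote_foldl_add (c : Context ℝ) : ∀ (l : List Expr) (a : Expr),
    (l.foldl (fun acc b => .add acc b) a).denote c = a.denote c + (l.map fun e => e.denote c).sum
  | [], a => by rw [List.foldl_nil, List.map_nil, List.sum_nil, add_zero]
  | b :: l, a => by rw [List.foldl_cons, denote_foldl_add c l, denote_add, List.map_cons, List.sum_cons, add_assoc]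

/-- `sumBal fuel l` denotes the sum of the denotations. [this work] -/
theorem denote_sumBal (c : Context ℝ) : ∀ (fuel : ℕ) (l : List Expr), (sumBal fuel l).denote c = (l.map fun e => e.denote c).sum
  | 0, l => by rw [sumBal, denote_foldl_add, denote_natCast, Nat.cast_zero, zero_add]
  | _ + 1, [] => by rw [sumBal, denote_natCast, List.map_nil, List.sum_nil, Nat.cast_zero]
  | _ + 1, [a] => by rw [sumBal, List.map_singleton, List.sum_singleton]
  | fuel + 1, a :: b :: l => by rw [sumBal, denote_sumBal c fuel, denote_pairUp_sum]

/-- Well-formedness of a block: cell indices below 15 everywhere. [this work] -/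
def RowBlock.wf (b : RowBlock) : Bool :=
  (match b.row with | .cell i => decide (i < 15) | _ => true) && b.mult.all fun t => t.2.1.all fun i => decide (i < 15)

/-- The value of the whole certificate: `Σ_blocks Σ_terms multTermVal · rowVal`. [this work] -/
noncomputable def certVal (bs : List RowBlock) (x : ℕ → ℝ) : ℝ :=
  (bs.map fun b => ((b.mult.map fun t => multTermVal t x * rowVal b.row x)).sum).sum

/-- `certE bs` denotes `certVal bs x` for well-formed blocks. [this work] -/
theorem denote_certE (bs : List RowBlock) (hwf : ∀ b ∈ bs, b.wf = true) : (certE bs).denote (ctxOf x) = certVal bs x := by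
  rw [certE, denote_sumBal]
  induction bs with
  | nil => simp [certTermsE, certVal]
  | cons b bs ih =>
    have hb := hwf b (by simp)
    simp only [RowBlock.wf, Bool.and_eq_true, List.all_eq_true, decide_eq_true_eq] at hb
    have hrow : ∀ i, b.row = .cell i → i < 15 := by
      intro i hi; have h1 := hb.1; rw [hi] at h1; simpa using h1
    have e1 : ((blockTermsE b).map fun e => e.denote (ctxOf x)).sum = (b.mult.map fun t => multTermVal t x * rowVal b.row x).sum := by
      rw [blockTermsE, List.map_map]
      congr 1
      refine List.map_congr_left fun t ht => ?_
      rw [Function.comp_apply, denote_mul, denote_multTermE x t (hb.2 t ht), denote_rowE x b.row hrow]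
    rw [certTermsE, List.map_append, List.sum_append, e1, ih (fun b' hb' => hwf b' (List.mem_cons_of_mem b hb'))]
    simp [certVal]

/-- **Nonnegativity of the certificate value**: nonnegative cells, `x 1 ≤ x 2`, nonnegative rows. [this work] -/
theorem certVal_nonneg (bs : List RowBlock) (hx : ∀ i, 0 ≤ x i) (hreg : x 1 ≤ x 2) (hrows : ∀ b ∈ bs, 0 ≤ rowVal b.row x) :
    0 ≤ certVal bs x := by
  unfold certVal
  refine List.sum_nonneg ?_
  intro v hv
  obtain ⟨b, hb, rfl⟩ := List.mem_map.1 hv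
  refine List.sum_nonneg ?_
  intro u hu
  obtain ⟨t, -, rfl⟩ := List.mem_map.1 hu
  exact mul_nonneg (multTermVal_nonneg x t hx hreg) (hrows b hb)

/-! ### The multiplier `M` -/

/-- Value of `M`. [this work] -/
noncomputable def polyVal (M : List (ℕ × List ℕ)) (x : ℕ → ℝ) : ℝ := (M.map fun t => (t.1 : ℝ) * monoVal t.2 x).sum

/-- `polyE M` denotes `polyVal M x`. [this work] -/
theorem denote_polyE (M : List (ℕ × List ℕ)) (hM : ∀ t ∈ M, ∀ i ∈ t.2, i < 15) : (polyE M).denote (ctxOf x) = polyVal M x := by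
  rw [polyE, denote_sumBal, polyVal, List.map_map]
  congr 1
  refine List.map_congr_left fun t ht => ?_
  rw [Function.comp_apply, denote_mul, denote_natCast, denote_monoE x _ (hM t ht)]

/-- **Positivity of `M`** from one square: if `xᵢ > 0` and `xᵢ²` occurs in `M` with a positive coefficient (cells nonnegative), then
`M > 0`. [this work] -/
theorem polyVal_pos_of_square (M : List (ℕ × List ℕ)) (hx : ∀ i, 0 ≤ x i) {i c : ℕ} (hxi : 0 < x i) (hc : 0 < c)
    (hcM : (c, [i, i]) ∈ M) : 0 < polyVal M x := by
  have hnn : ∀ v ∈ M.map (fun t => (t.1 : ℝ) * monoVal t.2 x), 0 ≤ v := by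
    intro v hv
    obtain ⟨t, -, rfl⟩ := List.mem_map.1 hv
    exact mul_nonneg (Nat.cast_nonneg _) (monoVal_nonneg x hx _)
  have hle : (c : ℝ) * monoVal [i, i] x ≤ polyVal M x :=
    List.single_le_sum hnn _ (List.mem_map.2 ⟨(c, [i, i]), hcM, rfl⟩)
  have hm : monoVal [i, i] x = x i * x i := by simp [monoVal]
  have hlt : 0 < (c : ℝ) * monoVal [i, i] x := by rw [hm]; exact mul_pos (Nat.cast_pos.2 hc) (mul_pos hxi hxi)
  exact lt_of_lt_of_le hlt hle

/-- A monomial containing a vanishing cell vanishes. [this work] -/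
theorem monoVal_eq_zero_of_mem : ∀ (l : List ℕ) {i : ℕ}, i ∈ l → x i = 0 → monoVal l x = 0
  | [], _, hi, _ => absurd hi List.not_mem_nil
  | j :: l, i, hi, h0 => by
    rw [monoVal, List.map_cons, List.prod_cons]
    rcases List.mem_cons.1 hi with rfl | hi
    · rw [h0, zero_mul]
    · have := monoVal_eq_zero_of_mem l hi h0
      rw [monoVal] at this
      rw [this, mul_zero]

/-- A polynomial all of whose monomials contain a vanishing cell vanishes. [this work] -/
theorem polyVal_eq_zero_of_vanish (M : List (ℕ × List ℕ)) (P : ℕ → Bool) (hP : ∀ i, P i = true → x i = 0)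
    (hM : ∀ t ∈ M, ∃ i ∈ t.2, P i = true) : polyVal M x = 0 := by
  unfold polyVal
  refine List.sum_eq_zero ?_
  intro v hv
  obtain ⟨t, ht, rfl⟩ := List.mem_map.1 hv
  obtain ⟨i, hi, hPi⟩ := hM t ht
  rw [monoVal_eq_zero_of_mem x t.2 hi (hP i hPi), mul_zero]

/-! ### The target -/

/-- The homogenised (L1) form as a function of the 15 cells:
`E₃(D_bc, D_ac, G_ab) + E₃(D_bc, G_ac, D_ab) − σ · «a|bcy» · m(D_bc)`. [this work] -/
noncomputable def L1hom (x : ℕ → ℝ) : ℝ :=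
  e3val (gsepMask 2 4) (gsepMask 1 4) (gsepMask 9 2) x + e3val (gsepMask 2 4) (gsepMask 9 4) (gsepMask 1 2) x
    - msum full x * x 7 * msum (gsepMask 2 4) x

/-- `l1E` denotes `L1hom x`. [this work] -/
theorem denote_l1E : l1E.denote (ctxOf x) = L1hom x := by
  simp only [l1E, L1hom, sigmaE, denote_sub, denote_add, denote_mul, denote_e3E, denote_maskE, denote_var x (show 7 < 15 by norm_num)]

/-- **The certificate inequality**: if the kernel check holds, blocks are well formed, cells are nonnegative with `x 1 ≤ x 2` and every row
is nonnegative, then `M(x) · L1hom(x) ≥ 0`. [this work] -/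
theorem polyVal_mul_L1hom_nonneg {M : List (ℕ × List ℕ)} {bs : List RowBlock} (hcheck : check M bs = true)
    (hM : ∀ t ∈ M, ∀ i ∈ t.2, i < 15) (hwf : ∀ b ∈ bs, b.wf = true)
    (hx : ∀ i, 0 ≤ x i) (hreg : x 1 ≤ x 2) (hrows : ∀ b ∈ bs, 0 ≤ rowVal b.row x) : 0 ≤ polyVal M x * L1hom x := by
  have h := denote_eq_of_check (ctxOf x) hcheck
  rw [denote_mul, denote_polyE x M hM, denote_l1E, denote_certE x bs hwf] at h
  rw [h]
  exact certVal_nonneg x bs hx hreg hrows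

end FourPointCert

end Summit.CriticalPhenomena.PercolationContinuityZ3.Theorems
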